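import Mathlib
import HarnessLib
import Summits.HubbardSuperconductivity.HubbardSuperconductivity.Theorems.KLProgrammeKLRegimeVolumeLimitSiteKernel
import Literature.Probability.LatticeModels.TorusFourierProofs
import Literature.Probability.LatticeModels.TorusCentredLift

/-!
# Route `KLProgramme` — crux K3, child «VolumeLimit»: the CENTRED-LIFT SITE KERNEL of a momentum function on the torus, and the
# DEFINITIONAL position-space door into `FinalTwoLegVolLimit β U μ K Mstar`
# (cell gate-hubbard-kl, seat hubbard-kl-r2d-p2 g2 — consumer side of the VL slot; `--supports` the VolumeLimit child)

The position-space door `volLimit_of_siteKernel` / `finalTwoLegVolLimit_of_siteKernel` (`…VolumeLimitSiteKernel`, p470119) takes a site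
representation `Σ̂_{L,M}(ω, k⃗, σ) = Σ_z χ_z(p_{k⃗}) · Spos_{L,M}(ω; z, σ)` as a HYPOTHESIS.  This module makes that representation
CANONICAL and FREE: for any momentum function `f` on the torus `(ℤ/Lℤ)^d`, its **site kernel** `siteKernel f : Site d → ℂ` is the
inverse discrete Fourier transform `torusFourierInv f` read on the CENTRED representatives (`Torus.cRep`, coordinates in `(-L/2, L/2]`)
and `0` at every other integer site, and

  `f k⃗ = Σ_{z ∈ ℤ^d} e^{-i p_{k⃗}·z} · siteKernel f z`   (`hasSum_siteKernel`; a finite sum written as a `HasSum` over the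
  `L`-INDEPENDENT index set `ℤ^d`; Fourier inversion on the torus, `torusFourier_torusFourierInv_holds`, + the character identity
  `χ_{k⃗}(z̄) = e^{i p_{k⃗}·z}` for EVERY integer representative `z`, `torusChar_proj_eq_exp`).

Hence the **definitional door** `finalTwoLegVolLimit_of_siteDecay`: the VL text of the frame `K` follows from two statements about ONE
named object, the site kernel `z ↦ siteKernel (Σ̂_{L,M}(ω, ·, σ)) z` of the two-leg vertex function of the fully integrated
countertermed action — (a) a summable decay majorant `m(z)` uniform in `(L, M, ω)` beyond `(L₀, Mstar)`, (b) per-site convergence at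
every Matsubara integer (eventually in `L`, then in `M`) — with NO representation hypothesis and no momentum-space continuity.  This is
the shape in which a cluster expansion on the torus exports its two-leg kernel (decay in the torus distance, uniform in the volume;
termwise limits site by site), and the object a position-space volume-limit slot of a later bundle would name.

Contents: `siteKernel` (definition) · `siteKernel_cRep` / `siteKernel_of_ne` · `torusChar_proj_eq_exp` ·
`hasSum_siteKernel` · `finalTwoLegVolLimit_of_siteDecay` (+ the frequency-dependent-majorant twin `finalTwoLegVolLimit_of_siteDecay_freq`).
One definition with `rfl`-level API and its consequences; nothing is asserted about the model.
-/

noncomputable section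

namespace Summit.HubbardSuperconductivity.HubbardSuperconductivity.Theorems.KLRegimeSplit

set_option linter.dupNamespace false -- summit = problem name (single-conjunct summit), D-0017

open Filter Topology Finset Literature.MathematicalPhysics.QuantumLattice Literature.Probability.LatticeModels
open Summit.HubbardSuperconductivity.HubbardSuperconductivity.Theorems.KLProgrammeLegKernels
open scoped ComplexConjugate

/-! ## §1 The centred-lift site kernel -/

/-- **The site kernel of a momentum function on the torus** `(ℤ/Lℤ)^d`: the inverse discrete Fourier transform
`torusFourierInv f = L^{-d} Σ_{k⃗} f(k⃗) χ_{k⃗}` read at the torus class of the integer site `z` WHEN `z` is the centred representative of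
its class (`Torus.cRep`, every coordinate in `(-L/2, L/2]`), and `0` at every other site — the torus kernel lifted to `ℤ^d`, supported in
the centred fundamental domain. -/
def siteKernel {d L : ℕ} [NeZero L] (f : TorusSite d L → ℂ) (z : Site d) : ℂ :=
  if Torus.cRep (Torus.proj L z) = z then torusFourierInv f (Torus.proj L z) else 0

section Kernel

variable {d L : ℕ} [NeZero L]

/-- On a centred representative the site kernel is the inverse Fourier transform at that class. -/
theorem siteKernel_cRep (f : TorusSite d L → ℂ) (u : TorusSite d L) :
    siteKernel f (Torus.cRep u) = torusFourierInv f u := by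
  rw [siteKernel, Torus.proj_cRep, if_pos rfl]

/-- Off the centred fundamental domain the site kernel vanishes. -/
theorem siteKernel_of_ne (f : TorusSite d L → ℂ) {z : Site d} (hz : Torus.cRep (Torus.proj L z) ≠ z) : siteKernel f z = 0 := by
  rw [siteKernel, if_neg hz]

/-- The site kernel is supported in the image of the centred lift. -/
theorem siteKernel_eq_zero_of_not_mem_range (f : TorusSite d L → ℂ) {z : Site d} (hz : z ∉ Set.range (Torus.cRep (L := L))) :
    siteKernel f z = 0 :=
  siteKernel_of_ne f fun h => hz ⟨_, h⟩

/-- **The character at ANY integer representative**: `χ_{k⃗}(z̄) = exp(i p_{k⃗}·z)`, `p_{k⃗} = latticeMomentum L k⃗ = 2πk⃗/L`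
(no reduction of `z` modulo `L` needed: `e^{2πi k z/L}` is `L`-periodic in `z`). -/
theorem torusChar_proj_eq_exp (k : TorusSite d L) (z : Site d) :
    torusChar k (Torus.proj L z) = Complex.exp (Complex.I * ((∑ i, latticeMomentum L k i * (z i : ℝ) : ℝ) : ℂ)) := by
  unfold torusChar
  have h1 : ∀ i, (ZMod.stdAddChar (k i * Torus.proj L z i) : ℂ) =
      Complex.exp (Complex.I * ((latticeMomentum L k i * (z i : ℝ) : ℝ) : ℂ)) := by
    intro i
    have hk : (k i : ZMod L) * Torus.proj L z i = ((((k i).val : ℤ) * z i : ℤ) : ZMod L) := by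
      simp only [Torus.proj]
      push_cast
      rw [ZMod.natCast_zmod_val]
    rw [hk, ZMod.stdAddChar_coe]
    congr 1
    simp only [latticeMomentum]
    push_cast
    ring
  simp_rw [h1, ← Complex.exp_sum, ← Finset.mul_sum]
  congr 2
  push_cast
  rfl

/-- The conjugate character at an integer representative: `conj χ_{k⃗}(z̄) = exp(-i p_{k⃗}·z)` — the kernel of `torusFourier`. -/
theorem conj_torusChar_proj_eq_exp (k : TorusSite d L) (z : Site d) :
    conj (torusChar k (Torus.proj L z)) = Complex.exp (Complex.I * (((-1) * ∑ i, latticeMomentum L k i * (z i : ℝ) : ℝ) : ℂ)) := by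
  rw [torusChar_proj_eq_exp, ← Complex.exp_conj]
  congr 1
  rw [map_mul, Complex.conj_I, Complex.conj_ofReal]
  push_cast
  ring

/-- **Fourier inversion as a site series**: every momentum function on the torus is the plane-wave series of its site kernel,
`f(k⃗) = Σ_{z ∈ ℤ^d} e^{-i p_{k⃗}·z} · siteKernel f z` (a finite sum over the centred fundamental domain, as a `HasSum` over `ℤ^d`). -/
theorem hasSum_siteKernel (f : TorusSite d L → ℂ) (k : TorusSite d L) :
    HasSum (fun z : Site d =>
      Complex.exp (Complex.I * (((-1) * ∑ i, latticeMomentum L k i * (z i : ℝ) : ℝ) : ℂ)) * siteKernel f z) (f k) := by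
  classical
  -- the support: centred representatives
  set s : Finset (Site d) := Finset.univ.image (Torus.cRep (L := L)) with hs
  have hzero : ∀ z ∉ s, Complex.exp (Complex.I * (((-1) * ∑ i, latticeMomentum L k i * (z i : ℝ) : ℝ) : ℂ)) * siteKernel f z = 0 := by
    intro z hz
    rw [siteKernel_eq_zero_of_not_mem_range f ?_, mul_zero]
    rintro ⟨u, rfl⟩
    exact hz (Finset.mem_image_of_mem _ (Finset.mem_univ u))
  have hsum : ∑ z ∈ s, Complex.exp (Complex.I * (((-1) * ∑ i, latticeMomentum L k i * (z i : ℝ) : ℝ) : ℂ)) * siteKernel f z = f k := by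
    rw [hs, Finset.sum_image fun u _ v _ h => Torus.cRep_injective h]
    have hinv := torusFourier_torusFourierInv_holds (d := d) (L := L) f
    have hk : torusFourier (torusFourierInv f) k = f k := by rw [hinv]
    rw [← hk, torusFourier_eq_sum_torusChar]
    refine Finset.sum_congr rfl fun u _ => ?_
    rw [siteKernel_cRep, ← conj_torusChar_proj_eq_exp, Torus.proj_cRep, mul_comm]
  rw [← hsum]
  exact hasSum_sum_of_ne_finset_zero hzero

/-- The site kernel is bounded by the inverse Fourier transform it lifts. -/
theorem norm_siteKernel_le (f : TorusSite d L → ℂ) (z : Site d) : ‖siteKernel f z‖ ≤ ‖torusFourierInv f (Torus.proj L z)‖ := by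
  unfold siteKernel
  split_ifs
  · exact le_rfl
  · rw [norm_zero]; exact norm_nonneg _

end Kernel

/-! ## §2 The definitional position-space door -/

/-- **Site decay + per-site limits of the site kernel ⇒ `FinalTwoLegVolLimit β U μ K Mstar`.**  Let
`Σ̂_{L,M}(ω, ·, σ) = klSelfEnergy L M β U μ K klE0 (nScales β + 1) (ω, ·) σ` be the two-leg vertex function of the fully integrated
countertermed action of the frame `K`, and `S_{L,M}(ω; z, σ) := siteKernel (Σ̂_{L,M}(ω, ·, σ)) z` its centred-lift site kernel.  If
(a) `‖S_{L,M}(ω; z, σ)‖ ≤ m(z)` beyond `(L₀, Mstar)` for a summable `m`, uniformly in `(L, M, ω)`, and (b) for every Matsubara integer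
`n`, spin `σ` and site `z`, `S_{L,M}(ω_n; z, σ) → SposInf n z σ` eventually in `L` and then in `M`, then the volume-limit text holds
(with `Σ∞(n, p, σ) = Σ_z e^{-ip·z} SposInf n z σ` and `B = Σ_z m z`). -/
theorem finalTwoLegVolLimit_of_siteDecay {β U μ : ℝ} {K : TrigPolyC4v} {Mstar : ℕ → ℕ}
    {SposInf : ℤ → Site 2 → Fin 2 → ℂ} {m : Site 2 → ℝ} (hm : Summable m) {L₀ : ℕ}
    (hmaj : ∀ (z : Site 2) (L : ℕ) [NeZero L], L₀ ≤ L → ∀ (M : ℕ) [NeZero M], Mstar L ≤ M →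
      ∀ (ω : MatsubaraIdx M) (σ : Fin 2),
        ‖siteKernel (fun k => klSelfEnergy L M β U μ K klE0 (nScales β + 1) (ω, k) σ) z‖ ≤ m z)
    (hlim : ∀ (n : ℤ) (σ : Fin 2) (z : Site 2) (ε : ℝ), 0 < ε → ∃ L₁ : ℕ, ∀ (L : ℕ) [NeZero L], L₁ ≤ L →
      ∃ M₁ : ℕ, ∀ (M : ℕ) [NeZero M], M₁ ≤ M → ∀ ω : MatsubaraIdx M, matsubaraInt M ω = n →
        ‖siteKernel (fun k => klSelfEnergy L M β U μ K klE0 (nScales β + 1) (ω, k) σ) z - SposInf n z σ‖ ≤ ε) :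
    FinalTwoLegVolLimit β U μ K Mstar :=
  finalTwoLegVolLimit_of_siteKernel (χ := fun z p => Complex.exp (Complex.I * (((-1) * ∑ i, p i * (z i : ℝ) : ℝ) : ℂ)))
    (continuous_planeWaveChar (-1)) (norm_planeWaveChar_le_one (-1))
    (Spos := fun L M _ _ ω z σ => siteKernel (fun k => klSelfEnergy L M β U μ K klE0 (nScales β + 1) (ω, k) σ) z)
    hm (L₀ := L₀) (fun _ _ _ _ _ _ _ k _ => hasSum_siteKernel _ k) hmaj hlim

/-- **The same with a frequency-dependent decay majorant** `m n z` (`Σ_z m n z ≤ B` for every Matsubara integer `n`). -/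
theorem finalTwoLegVolLimit_of_siteDecay_freq {β U μ : ℝ} {K : TrigPolyC4v} {Mstar : ℕ → ℕ}
    {SposInf : ℤ → Site 2 → Fin 2 → ℂ} {m : ℤ → Site 2 → ℝ} (hm : ∀ n : ℤ, Summable (m n)) {B : ℝ}
    (hB : ∀ n : ℤ, ∑' z, m n z ≤ B) {L₀ : ℕ}
    (hmaj : ∀ (z : Site 2) (L : ℕ) [NeZero L], L₀ ≤ L → ∀ (M : ℕ) [NeZero M], Mstar L ≤ M →
      ∀ (ω : MatsubaraIdx M) (σ : Fin 2),
        ‖siteKernel (fun k => klSelfEnergy L M β U μ K klE0 (nScales β + 1) (ω, k) σ) z‖ ≤ m (matsubaraInt M ω) z)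
    (hlim : ∀ (n : ℤ) (σ : Fin 2) (z : Site 2) (ε : ℝ), 0 < ε → ∃ L₁ : ℕ, ∀ (L : ℕ) [NeZero L], L₁ ≤ L →
      ∃ M₁ : ℕ, ∀ (M : ℕ) [NeZero M], M₁ ≤ M → ∀ ω : MatsubaraIdx M, matsubaraInt M ω = n →
        ‖siteKernel (fun k => klSelfEnergy L M β U μ K klE0 (nScales β + 1) (ω, k) σ) z - SposInf n z σ‖ ≤ ε) :
    FinalTwoLegVolLimit β U μ K Mstar :=
  finalTwoLegVolLimit_of_siteKernel_freq (χ := fun z p => Complex.exp (Complex.I * (((-1) * ∑ i, p i * (z i : ℝ) : ℝ) : ℂ)))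
    (continuous_planeWaveChar (-1)) (norm_planeWaveChar_le_one (-1))
    (Spos := fun L M _ _ ω z σ => siteKernel (fun k => klSelfEnergy L M β U μ K klE0 (nScales β + 1) (ω, k) σ) z)
    hm hB (L₀ := L₀) (fun _ _ _ _ _ _ _ k _ => hasSum_siteKernel _ k) hmaj hlim

end Summit.HubbardSuperconductivity.HubbardSuperconductivity.Theorems.KLRegimeSplit

end
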